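import Mathlib.Analysis.Complex.Trigonometric
import Literature.NumberTheory.Transcendental.TubbsPeriodsIndependence
import Literature.NumberTheory.Transcendental.ExpSmallTrdeg
import Literature.NumberTheory.Transcendental.ChudnovskyPeriods
import HarnessLib

/-!
# Tubbs 1990, Theorem 4 (periods form) — proved reduction layer

Topic `Literature/NumberTheory/Transcendental` (trunk T-TRANSCEND). First (top) layer of the proof
of the named fact `Literature.NumberTheory.Transcendental.Tubbs1990_thm4_periods`
(`TubbsPeriodsIndependence.lean`; R. Tubbs, *Algebraic groups and small transcendence degree, II*,
J. Number Theory 35 (1990), Thm 4 p. 112 and Remark p. 114 = Chudnovsky 1984, Ch. 7, Thm 4.1 (i)):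
for every lattice basis `(ω₁, ω₂)` and `c ≠ 0`,
`trdeg_ℚ ℚ(g₂, g₃, ω₁, ω₂, c, e^{cω₁}, e^{cω₂}) ≥ 2`.

The printed proof (Tubbs §5, pp. 124–127, "we prove Theorem 3 and Theorem 4 together") is
Gel'fond's method in one variable on `G = 𝔾ₐ × 𝔾ₘ × E` with `φ(z) = (z, e^{λz}, p(z))`,
`p = (σ³, σ³℘, σ³℘′)`, and begins (p. 124): "if we assume that these theorems are false, then in
each case `K = ℚ(θ, η)` where `θ` is transcendental and `η` is integral over `ℤ[θ]`". This file
PROVES that opening reduction in the tree's standard `θ`-form (cf. `ExpSmallTrdeg.lean`,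
`ChudnovskyMain.lean`): it suffices to show that for NO transcendental `θ` are all seven numbers
algebraic over `ℚ(θ)` (`Tubbs1990_thm4_periods_of_thetaForm`; the case "all seven algebraic" is
absorbed by choosing an auxiliary transcendental `θ`, so no separate appeal to Schneider's theorem
on the transcendence of periods is needed). It also records the elementary fact used when the
obstruction subgroups of Philippon's zero estimate are counted on the lattice points
`n₁ω₁ + n₂ω₂` (Tubbs, proof of Cor. 5.2, p. 126: "`card((X + G*)/G*) ≥ S`"): for `c ≠ 0` the two
numbers `e^{cω₁}, e^{cω₂}` cannot both have absolute value `1`, because `cω₁, cω₂` are not both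
purely imaginary (`ω₂/ω₁ ∉ ℝ`) — so along one of the two basis directions the points
`e^{c(n₁ω₁ + n₂ω₂)}` of `𝔾ₘ` are pairwise distinct.

What remains for `Tubbs1990_thm4_periods_holds` is the `θ`-form itself: Prop. 5.1 (Siegel's lemma,
tree: `ChudnovskySiegel.lean`, `ChudnovskyEnvelope.lean`), Cor. 5.2 (non-vanishing via Philippon's
1986 zero estimate on `𝔾ₐ × 𝔾ₘ × E` with TRIDEGREES — not in the tree: `Philippon1986_GaGm` has no
elliptic factor and `philippon1986_std` / `AnalyticGroupModel.zero_estimate` are single-graded),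
Schwarz's lemma (`ChudnovskyAnalytic.lean`) and Gel'fond's criterion
(`GelfondCriterionProofs.lean`).

## Contents (everything PROVED, no definitions)

* `PeriodPair.re_mul_ω₁_ne_zero_or`, `PeriodPair.norm_exp_mul_ω_ne_one_or` — `cω₁, cω₂` are not
  both purely imaginary; `|e^{cω₁}| ≠ 1` or `|e^{cω₂}| ≠ 1`.
* `Tubbs1990_thm4_periods_of_thetaForm` — the reduction to the `θ`-form.
* `tubbsSet_swap`, `PeriodPair.swap_G`, `PeriodPair.swap_g₂`, `PeriodPair.swap_g₃`,
  `tubbsSet_of_swap` — the generating set is symmetric in the two basis periods;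
* `Tubbs1990_thm4_periods_of_norm_exp_ne_one` — WLOG `|e^{cω₂}| ≠ 1`.

## References

* R. Tubbs, J. Number Theory 35 (1990), Thm 4 (p. 112), Remark p. 114, §5 pp. 124–127. [Tubbs1990]
* G. V. Chudnovsky, *Contributions to the theory of transcendental numbers* (1984), Ch. 7
  Thm 4.1 (i), p. 318. [Chudnovsky1984]
-/

noncomputable section

open Complex IntermediateField

/-! ### The two exponentials `e^{cω₁}, e^{cω₂}` are not both unimodular -/

namespace PeriodPair

variable (L : PeriodPair)

/-- For `c ≠ 0`, the numbers `cω₁, cω₂` are not both purely imaginary: otherwise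
`ω₂/ω₁ = (cω₂)/(cω₁)` would be real, contradicting the `ℝ`-linear independence of the basis
periods (`PeriodPair.im_ω₂_div_ω₁_ne_zero`). [folklore] -/
theorem re_mul_ω₁_ne_zero_or {c : ℂ} (hc : c ≠ 0) :
    (c * L.ω₁).re ≠ 0 ∨ (c * L.ω₂).re ≠ 0 := by
  by_contra h
  push Not at h
  obtain ⟨h1, h2⟩ := h
  have hcω₁ : c * L.ω₁ ≠ 0 := mul_ne_zero hc L.ω₁_ne_zero
  -- `ω₂/ω₁ = (cω₂)/(cω₁)` is a quotient of two purely imaginary numbers, hence real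
  have hq : L.ω₂ / L.ω₁ = (c * L.ω₂) / (c * L.ω₁) := by
    rw [mul_div_mul_left _ _ hc]
  have him : ((c * L.ω₂) / (c * L.ω₁)).im = 0 := by
    rw [Complex.div_im, h1, h2]
    ring
  exact L.im_ω₂_div_ω₁_ne_zero (hq ▸ him)

/-- For `c ≠ 0`, at least one of `e^{cω₁}, e^{cω₂}` has absolute value `≠ 1`
(`‖e^{w}‖ = e^{Re w}`). Along that basis direction the points `e^{c nω}` (`n ∈ ℤ`) of `𝔾ₘ` are
pairwise distinct, which is what the count `card((X + G*)/G*) ≥ S` in Tubbs's treatment of the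
obstruction subgroups uses. [cite: Tubbs1990, proof of Cor. 5.2 (p. 126)] -/
theorem norm_exp_mul_ω_ne_one_or {c : ℂ} (hc : c ≠ 0) :
    ‖Complex.exp (c * L.ω₁)‖ ≠ 1 ∨ ‖Complex.exp (c * L.ω₂)‖ ≠ 1 := by
  rcases L.re_mul_ω₁_ne_zero_or hc with h | h
  · left
    rw [Complex.norm_exp]
    exact fun h1 => h (by simpa using congrArg Real.log h1)
  · right
    rw [Complex.norm_exp]
    exact fun h1 => h (by simpa using congrArg Real.log h1)

end PeriodPair

namespace Literature.NumberTheory.Transcendental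

/-! ### The reduction to the `θ`-form -/

/-- **Reduction of Tubbs 1990, Theorem 4 (periods form) to its `θ`-form** (Tubbs §5, p. 124:
"if we assume that these theorems are false, then in each case `K = ℚ(θ, η)` where `θ` is
transcendental"; Baker 1975, Ch. 12 §5 architecture, tree lemma
`exists_theta_of_not_two_le_trdeg`): if for every transcendental `θ` and every lattice basis and
`c ≠ 0` the seven numbers `g₂, g₃, ω₁, ω₂, c, e^{cω₁}, e^{cω₂}` are NOT all algebraic over `ℚ(θ)`,
then `Tubbs1990_thm4_periods` holds. (The hypothesis is what the main argument — Siegel's lemma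
with `ℤ[θ]`-coefficients, the zero estimate, Schwarz's lemma, the norm to `ℤ[θ]` and Gel'fond's
criterion — has to deliver.) [cite: Tubbs1990, §5 p. 124] -/
theorem Tubbs1990_thm4_periods_of_thetaForm
    (h : ∀ θ : ℂ, Transcendental ℚ θ → ∀ (L : PeriodPair) (c : ℂ), c ≠ 0 →
      ¬ ∀ s ∈ ({L.g₂, L.g₃, L.ω₁, L.ω₂, c, Complex.exp (c * L.ω₁), Complex.exp (c * L.ω₂)} :
          Set ℂ), IsAlgebraic ℚ⟮θ⟯ s) :
    Tubbs1990_thm4_periods := by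
  intro L c hc
  by_contra hlt
  obtain ⟨θ, hθ, halg⟩ := exists_theta_of_not_two_le_trdeg _ hlt
  exact h θ hθ L c hc halg

/-- The `θ`-form may equivalently be asked only up to the order of the two basis periods: the
generating set `{g₂, g₃, ω₁, ω₂, c, e^{cω₁}, e^{cω₂}}` is literally the same set for the swapped
basis `(ω₂, ω₁)` once `g₂, g₃` are known to agree, so any statement about it for `L` is the
statement for `L.swap` (`PeriodPair.swap`). Here: the set with the roles of `ω₁, ω₂` exchanged in
the last five entries is the same set. [folklore] -/
theorem tubbsSet_swap (L : PeriodPair) (c : ℂ) :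
    ({L.g₂, L.g₃, L.ω₂, L.ω₁, c, Complex.exp (c * L.ω₂), Complex.exp (c * L.ω₁)} : Set ℂ) =
      {L.g₂, L.g₃, L.ω₁, L.ω₂, c, Complex.exp (c * L.ω₁), Complex.exp (c * L.ω₂)} := by
  ext x
  simp only [Set.mem_insert_iff, Set.mem_singleton_iff]
  tauto

/-! ### Swapping the basis periods; WLOG `|e^{cω₂}| ≠ 1` -/

/-- The Eisenstein sums `G_n` depend only on the lattice, so they are unchanged when the two basis
periods are interchanged (`PeriodPair.swap_lattice`). [folklore] -/
@[simp] theorem _root_.PeriodPair.swap_G (L : PeriodPair) (n : ℕ) : L.swap.G n = L.G n := by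
  unfold PeriodPair.G
  rw [PeriodPair.swap_lattice]

/-- `g₂` is unchanged when the basis periods are interchanged. [folklore] -/
@[simp] theorem _root_.PeriodPair.swap_g₂ (L : PeriodPair) : L.swap.g₂ = L.g₂ := by
  simp [PeriodPair.g₂]

/-- `g₃` is unchanged when the basis periods are interchanged. [folklore] -/
@[simp] theorem _root_.PeriodPair.swap_g₃ (L : PeriodPair) : L.swap.g₃ = L.g₃ := by
  simp [PeriodPair.g₃]

/-- The generating set `{g₂, g₃, ω₁, ω₂, c, e^{cω₁}, e^{cω₂}}` of Tubbs's field is the same for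
the swapped basis. [folklore] -/
theorem tubbsSet_of_swap (L : PeriodPair) (c : ℂ) :
    ({L.swap.g₂, L.swap.g₃, L.swap.ω₁, L.swap.ω₂, c, Complex.exp (c * L.swap.ω₁),
        Complex.exp (c * L.swap.ω₂)} : Set ℂ) =
      {L.g₂, L.g₃, L.ω₁, L.ω₂, c, Complex.exp (c * L.ω₁), Complex.exp (c * L.ω₂)} := by
  rw [PeriodPair.swap_g₂, PeriodPair.swap_g₃, PeriodPair.swap_ω₁, PeriodPair.swap_ω₂]
  exact tubbsSet_swap L c

/-- **WLOG `|e^{cω₂}| ≠ 1`.** To prove `Tubbs1990_thm4_periods` it suffices to treat lattice bases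
and `c ≠ 0` with `‖e^{cω₂}‖ ≠ 1`: by `PeriodPair.norm_exp_mul_ω_ne_one_or` one of the two
exponentials is not unimodular, and interchanging the basis periods does not change the field
(`tubbsSet_of_swap`). In the main argument this normalisation makes the `𝔾ₘ`-coordinates
`e^{c(n₁ω₁ + n₂ω₂)}` of the lattice points pairwise distinct along `n₂`, which is the count
`card((X + G*)/G*) ≥ S` of Tubbs's obstruction-subgroup analysis.
[cite: Tubbs1990, proof of Cor. 5.2 (p. 126)] -/
theorem Tubbs1990_thm4_periods_of_norm_exp_ne_one
    (h : ∀ (L : PeriodPair) (c : ℂ), c ≠ 0 → ‖Complex.exp (c * L.ω₂)‖ ≠ 1 →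
      (2 : Cardinal) ≤ Algebra.trdeg ℚ ↥(adjoin ℚ
        ({L.g₂, L.g₃, L.ω₁, L.ω₂, c, Complex.exp (c * L.ω₁), Complex.exp (c * L.ω₂)} : Set ℂ))) :
    Tubbs1990_thm4_periods := by
  intro L c hc
  rcases L.norm_exp_mul_ω_ne_one_or hc with h1 | h2
  · have h' := h L.swap c hc (by simpa using h1)
    rwa [tubbsSet_of_swap] at h'
  · exact h L c hc h2

end Literature.NumberTheory.Transcendental

end
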